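import Summits.QuantumFields.YangMills.Theorems.UnitScaleTiltProp7AxialResidualFreedom
import Summits.QuantumFields.YangMills.Theorems.UnitScaleTiltProp7SPrintDefsS
import Summits.QuantumFields.YangMills.Theorems.UnitScaleTiltProp7SymAvgTwSymEq137
import Summits.QuantumFields.YangMills.Theorems.UnitScaleTiltProp7Chart5T3OfEq137cov
import HarnessLib

/-!
# `UnitScaleTiltProp7SymSliceWitness` — THE CHART-ΣS WITNESS: the symmetric slice's gauge transformation `ũ_S` EXISTS (route `UnitScaleTilt`, crux K1 «MinimiserStabilityRegPr»
# stmt-QuantumFields-19200, stub EX `stub_existenceMinimalOrbit`, route (α), node (α-S) = OWNER RULING g26-№19 ORDER (1) «explicit witness `ũ_S`» ∕ (2) FILE Aˢ; def-free,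
# count-neutral, `--supports stmt-QuantumFields-19200 --as helper`)

Cell `ym3-torus` ∕ width seat `ym-ust-20520-w5` (gen 4).  YM₃ on T³ is ladder rung R3 (HUMAN RULING D-0037) — not d = 4, not a mass gap, not the Clay problem; nothing
here is a claim about the stub, the crux or the gap.

THE PRINT AND THE RE-BASE.  [Balaban1985Variational] (20) «Q_j(U₀, ηA) = B on Λ_j» in its defining form [Balaban1985RegularSpaces] (1.28)–(1.30): the configuration `U₁U₀`,
`U₁ = e^{iX}`, is carried by a gauge transformation `u` into `Ax_k(𝔅_k, U₀) ∩ 𝔅_k(𝔅_k, V)`; print normalises `u` by (1.29) and then (87) of [Balaban1985Averaging] FORCES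
its `k`-centre values `u(y) = (\overline{R_{0,y}U₁}^{(k)})⁻¹`.  RULING g26-№19 (α-S) re-based the slice with the chart of record: `Prop7SPrint.AvgCondPrintS V U₀ X :=
∀ U₁ = e^{iX}, ∃ u, NormS u ∧ (U₁U₀)^u ∈ fibre V`, `NormS u := (U₁U₀)^u ∈ Ax_k(𝔅_k, U₀)` ((1.19), `IsAxialPrint`) `∧ u↓(y) = (w^{sym}_{iX}(y))⁻¹` (the inverse SYMMETRIC
accumulated frames `frameTwS` of ✓`Prop7SymAvgTwSym` as PRESCRIBED `k`-centre values).  Such `u` exist by [Balaban1985RegularSpaces] p. 79 «The conditions (1.19) determine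
uniquely an element in each orbit given by the subgroup (1.14)» read for the FULL gauge group — the axial gauge fixing with prescribed `k`-centre values, certified in the
sibling file `…Prop7AxialResidualFreedom` (`exists_gauge_topData_inAx`).  This file reads it at the T³ carrier and assembles the (20)ˢ supplier.

WHAT IS PROVED (sorry-free, no definition; member `F`, heights `n ≤ K`, `k = K − n`, `x₀ = Prop7SPrint.basePt F n K = embIter k 0`, `U♯ = pull (unitsField (toUField U)) x₀`):
* §1 ★`exists_topData_isAxialPrint` — for `SU(2)` configurations `U₀`, `W` with `pdev U₀♯, pdev W♯ < α·L^{−2k}` (`C₀α ≤ ⅓`, `2α ≤ c₂′`) and EVERY `c : Site (F.P K) k → SU(2)`: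
  `∃ u, (∀ ŷ, u (embIter k ŷ) = c ŷ) ∧ IsAxialPrint F n K U₀ (W^u)`; `descTransf_eq_embIter` (`u↓(y) = u(embIter k ŷ)`).
* §2 ★★★`exists_normS` — the CHART-ΣS WITNESS: under the same windows for `U₀`, `U₁U₀ = emb15 U₀ U₁` and the membership `hSU : frameTwS U₀ (iX) y ∈ SU(2)` (displayed),
  `∃ u, NormS F n K h U₀ X U₁ u` (top datum `c ŷ := (frameTwS U₀ (iX) y)⁻¹`); `exists_normS_of_regPr` — the windows READ from print's regularity (2):
  `RegPr F n K ε₀ U₀`, `RegPr F n K ε₁ (emb15 U₀ U₁)`, `10⁷L³ε₀ ≤ 1`, `10⁷L³ε₁ ≤ 1` (`windows_of_ten7`; `Prop7AxialReprPrint.inAk_pull_of_regPr`∕`pdev_pull_lt`).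
* §3 ★`avgCondPrintS_of_fibreClauseS` (+ `_of_regPr`) — `AvgCondPrintS V U₀ X` from the (20)ˢ fibre clause «∀ u with the symmetric centre clause, (e^{iX}U₀)^u ∈ 𝔅_k(V)» and a
  witness; ★★`avgCondPrintS_of_chart47twS` — FILE Aˢ's (20) step in ONE call: ✓`Prop7SymAvgTwSymEq137.fibreClauseS_of_chart47twS` ∘ `exists_normS_of_regPr` (hypotheses =
  those of `fibreClauseS_of_chart47twS` verbatim + `hSU`); `avgCondPrintS_of_mem_fibre_of_logChartTwS_eq_zero` — the EX case `U₀ ∈ 𝔅_k(V)`, `logChartTwS U₀ (iX) = 0`.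
HONEST SCOPE.  Composition by name of landed theorems + one numeric window lemma; no estimate.  DISPLAYED and NOT proved here: `hSU` — the unitarity∕unimodularity of the
symmetric accumulated frame on `SU(2)` data (`eml` of `SU(2)` elements is in `SU(2)` only inside the `log` window, `BlockAveragingExpMeanLog.eml_mem_specialUnitaryGroup`;
level-by-level under the W2∕W3 budgets of `…Prop7SymFrameIterSmall`∕`…Prop7SymFrameRelCluster`) — the next file of this seat.  `--supports stmt-QuantumFields-19200 --as helper`.

References: T. Bałaban, CMP **99** (1985) 75–102 [Balaban1985RegularSpaces] ((1.14)–(1.15) p.78, (1.19)–(1.20) p.79, (1.28)–(1.31) pp.81–82, (1.7) p.77); CMP **102** (1985) 277–309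
[Balaban1985Variational] ((2) p.278, (4) p.278, (18)–(20) pp.280–281, (47)–(49) p.285); CMP **98** (1985) 17–51 [Balaban1985Averaging] ((11) p.19, (52)–(54) p.26, (87)–(92) p.31, (97) p.32).
-/

set_option autoImplicit false

noncomputable section

namespace Summit.QuantumFields.YangMills.Theorems.Prop7SymSliceWitness

open NormedSpace
open Literature.MathematicalPhysics.QuantumFieldTheory.Balaban1983to89
open B7Prop1Explicit renaming Site → LSite
open B7Prop2Explicit (pdev C0 c2')
open Summit.QuantumFields.YangMills.Theorems.Prop7AxialResidualFreedom (exists_gauge_topData_inAx)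

section T3

open scoped Matrix.Norms.L2Operator
open Literature.MathematicalPhysics.QuantumFieldTheory.Balaban1983to89.T3ContinuumYM3Torus
open Literature.MathematicalPhysics.QuantumFieldTheory.Balaban1983to89.T3UnitLawDensityEML (ℰp)
open Literature.MathematicalPhysics.QuantumFieldTheory.Balaban1983to89.T3PrintedRegularMinimiser (RegPr)
open Literature.MathematicalPhysics.QuantumFieldTheory.Balaban1983to89.T3PrintedRegularOrbits (descTransf sites_eq)
open Literature.MathematicalPhysics.QuantumFieldTheory.Balaban1983to89.T3ConstrainedMinimiser (fibre)
open Literature.MathematicalPhysics.QuantumFieldTheory.Balaban1983to89.T3TiltDescent (descendTo)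
open T3LevelShift (siteShift)
open T4Continuum (transfUp)
open B7Prop2SpecialUnitary (specialUnitaryUnits mem_specialUnitaryUnits)
open B15DeterminingSets (embIter)
open B10Eq27TorusAxialLog (pull unitsField toUField suIncl val_suIncl)
open B8Thm2SetupTorus (toUGauge toUGauge_apply)
open B11Prop3Model (Dfix)
open MatrixLog (mlog)
open T3SectALandauChart (emb15)
open Summit.QuantumFields.YangMills.Theorems.Prop7SPrint (basePt IsAxialPrint NormS AvgCondPrintS)
open Summit.QuantumFields.YangMills.Theorems.Prop7TPrint (expHermField)
open Summit.QuantumFields.YangMills.Theorems.Prop7SymAvgTwSym (frameTwS dbarTwS QTwS CmapTwS Chart47T3twS)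
open Summit.QuantumFields.YangMills.Theorems.Prop7SymAvgTwSymEq137 (fibreClauseS_of_chart47twS fibreClauseS_of_logChartTwS_eq_zero)
open Summit.QuantumFields.YangMills.Theorems.Prop7Chart5T3OfEq137cov (eq_expHermField_of_exp)
open Summit.QuantumFields.YangMills.Theorems.Prop7AxialReprPrint (inAk_pull_of_regPr pdev_pull_lt)
open Summit.QuantumFields.YangMills.Theorems.Prop7FlatHolonomy (transfUp_eq_embIter)

variable (F : T3Family) {n K : ℕ} (h : n ≤ K)

/-! ## §1 Prescribed `k`-centre values in `Ax_k(𝔅_k, U₀)` at the T³ carrier -/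

/-- ★ **PRESCRIBED `k`-CENTRE VALUES IN `Ax_k(𝔅_k, U₀)` AT THE T³ CARRIER**: for `SU(2)` configurations `U₀`, `W` of the member's `K`-lattice whose pullbacks based at
`x₀ = basePt F n K` have `sup_p |·(∂p) − 1| < α·L^{−2k}` (`C₀α ≤ ⅓`, `2α ≤ c₂′`; `k = K − n`) and EVERY top datum `c : Site (F.P K) k → SU(2)` there is a gauge transformation `u`
with `u (embIter k ŷ) = c ŷ` at every `k`-centre and `W^u ∈ Ax_k(𝔅_k, U₀)` (`Prop7SPrint.IsAxialPrint`, print's (1.19) on the based pullbacks, `Λ = torusLam k`) —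
`Prop7AxialResidualFreedom.exists_gauge_topData_inAx` at `P := F.P K`, `N := 2`. [cite: Balaban1985RegularSpaces, (1.19) p.79, p.79 (sentence after (1.20)); Balaban1985Variational, (18) p.280] -/
theorem exists_topData_isAxialPrint {α : ℝ} (hα : 0 < α) (hα3 : C0 (F.P K).d * α ≤ 1 / 3) (hα2 : 2 * α ≤ c2' (F.P K).d (F.P K).L)
    (U₀ W : GaugeField (F.P K) 0 (Matrix.specialUnitaryGroup (Fin 2) ℂ))
    (h33 : pdev (pull (unitsField (toUField U₀)) (basePt F n K)) < α * ((((F.P K).L : ℝ) ^ (K - n))⁻¹) ^ 2)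
    (h34 : pdev (pull (unitsField (toUField W)) (basePt F n K)) < α * ((((F.P K).L : ℝ) ^ (K - n))⁻¹) ^ 2)
    (c : Site (F.P K) (K - n) → Matrix.specialUnitaryGroup (Fin 2) ℂ) :
    ∃ u : GaugeTransf (F.P K) 0 (Matrix.specialUnitaryGroup (Fin 2) ℂ),
      (∀ ŷ : Site (F.P K) (K - n), u (embIter (K - n) ŷ) = c ŷ) ∧ IsAxialPrint F n K U₀ (GaugeField.gaugeAct u W) := by
  have hk : K - n ≤ (F.P K).m + (F.P K).K := by show K - n ≤ F.m + K; omega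
  obtain ⟨u, hu, hAx⟩ := exists_gauge_topData_inAx (P := F.P K) (N := 2) (by norm_num) hk hα hα3 hα2 U₀ W h33 h34 c
  exact ⟨u, hu, hAx _⟩

/-- The descended gauge transformation reads the fine one at the `k`-centres: `u↓(y) = u(embIter k ŷ)`, `ŷ = siteShift y` ([Balaban1985Averaging] (12)–(13)).
[cite: Balaban1985Averaging, (12)–(13) p.19] -/
theorem descTransf_eq_embIter (u : GaugeTransf (F.P K) 0 (Matrix.specialUnitaryGroup (Fin 2) ℂ)) (y : Site (F.P n) 0) :
    descTransf F n K h u y = u (embIter (K - n) (siteShift (sites_eq F n K h) y)) := by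
  show transfUp u (K - n) (siteShift (sites_eq F n K h) y) = _
  rw [transfUp_eq_embIter]

/-! ## §2 The `NormS` witness -/

/-- ★★★ **THE CHART-ΣS WITNESS** (RULING g26-№19 ORDER (1) «explicit witness `ũ_S`»): for `SU(2)` configurations `U₀`, `U₁` with the based pullbacks of `U₀` and of
`U₁U₀ = emb15 U₀ U₁` inside the Prop.-1∕2 window (`pdev ·♯ < α·L^{−2k}`, `C₀α ≤ ⅓`, `2α ≤ c₂′`), and an exponent `X` whose symmetric accumulated frames `w^{sym}_{iX}(y) =
frameTwS U₀ (iX) y` are `SU(2)`-valued (`hSU`, displayed), there is a fine `SU(2)` gauge transformation `u` with `NormS F n K h U₀ X U₁ u`: `(U₁U₀)^u ∈ Ax_k(𝔅_k, U₀)` and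
`u↓(y) = (w^{sym}_{iX}(y))⁻¹` at every comparison site — §1 with the top datum `c ŷ := (frameTwS U₀ (iX) (siteShift⁻¹ ŷ))⁻¹`.
[cite: Balaban1985RegularSpaces, (1.19) p.79, (1.28)–(1.30) p.81; Balaban1985Averaging, (87) p.31, (97) p.32; Balaban1985Variational, (20) p.281] -/
theorem exists_normS {α : ℝ} (hα : 0 < α) (hα3 : C0 (F.P K).d * α ≤ 1 / 3) (hα2 : 2 * α ≤ c2' (F.P K).d (F.P K).L)
    (U₀ : GaugeField (F.P K) 0 (Matrix.specialUnitaryGroup (Fin 2) ℂ)) (X : PBond (F.P K) 0 → Matrix (Fin 2) (Fin 2) ℂ)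
    (U₁ : GaugeField (F.P K) 0 (Matrix.specialUnitaryGroup (Fin 2) ℂ))
    (h33 : pdev (pull (unitsField (toUField U₀)) (basePt F n K)) < α * ((((F.P K).L : ℝ) ^ (K - n))⁻¹) ^ 2)
    (h34 : pdev (pull (unitsField (toUField (emb15 U₀ U₁))) (basePt F n K)) < α * ((((F.P K).L : ℝ) ^ (K - n))⁻¹) ^ 2)
    (hSU : ∀ y : Site (F.P n) 0, frameTwS F n K h U₀ (fun b => Complex.I • X b) y ∈ specialUnitaryUnits (Fin 2)) :
    ∃ u : GaugeTransf (F.P K) 0 (Matrix.specialUnitaryGroup (Fin 2) ℂ), NormS F n K h U₀ X U₁ u := by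
  -- the prescribed top datum: the INVERSE symmetric accumulated frames, as `SU(2)` elements, indexed by the `k`-centres
  obtain ⟨u, hu, hAx⟩ := exists_topData_isAxialPrint F (n := n) hα hα3 hα2 U₀ (emb15 U₀ U₁) h33 h34
    (fun ŷ => ⟨(((frameTwS F n K h U₀ (fun b => Complex.I • X b) ((siteShift (sites_eq F n K h)).symm ŷ))⁻¹ :
        (Matrix (Fin 2) (Fin 2) ℂ)ˣ) : Matrix (Fin 2) (Fin 2) ℂ),
      mem_specialUnitaryUnits.1 ((specialUnitaryUnits (Fin 2)).inv_mem (hSU _))⟩)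
  refine ⟨u, hAx, fun y => ?_⟩
  apply Units.ext
  rw [Unitary.val_toUnits_apply, toUGauge_apply, val_suIncl, descTransf_eq_embIter, hu]
  simp only [Equiv.symm_apply_apply]

/-- **THE PROP.-1∕2 WINDOWS FROM THE CELL'S STANDING SMALLNESS**: `10⁷L³ε₀ ≤ 1`, `10⁷L³ε₁ ≤ 1` (and `L ≥ 3`) give `C₀·(2ε₀ + 2ε₁) ≤ ⅓` and `2(2ε₀ + 2ε₁) ≤ c₂′`
(`C₀ = 226·(8·4·7)² = 11339776`, `c₂′ = 1∕(14336L²)` at `d = 3`). [cite: Balaban1985Averaging, Prop. 2 (52)–(54) p.26] -/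
theorem windows_of_ten7 {ε₀ ε₁ : ℝ} (hε₀ : 0 ≤ ε₀) (hε₀' : 10 ^ 7 * (F.L : ℝ) ^ 3 * ε₀ ≤ 1)
    (hε₁ : 0 ≤ ε₁) (hε₁' : 10 ^ 7 * (F.L : ℝ) ^ 3 * ε₁ ≤ 1) :
    C0 (F.P K).d * (2 * ε₀ + 2 * ε₁) ≤ 1 / 3 ∧ 2 * (2 * ε₀ + 2 * ε₁) ≤ c2' (F.P K).d (F.P K).L := by
  have hL : (3 : ℝ) ≤ F.L := by
    have h3 : 3 ≤ F.L := by  -- `L` odd and `> 1` (reproved inline; cf. `Reg68LevelsOfFineRegular.three_le_L`)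
      obtain ⟨⟨t, ht⟩, h1⟩ := F.hL
      omega
    exact_mod_cast h3
  have hL0 : (0 : ℝ) ≤ F.L := by linarith
  show C0 3 * (2 * ε₀ + 2 * ε₁) ≤ 1 / 3 ∧ 2 * (2 * ε₀ + 2 * ε₁) ≤ c2' 3 F.L
  have hL3 : (27 : ℝ) ≤ (F.L : ℝ) ^ 3 := by
    have h := pow_le_pow_left₀ (by norm_num : (0 : ℝ) ≤ 3) hL 3
    norm_num at h
    exact h
  have hε₀b : 27 * (10 ^ 7 * ε₀) ≤ 1 :=
    le_trans (by nlinarith [mul_le_mul_of_nonneg_right hL3 (by positivity : (0 : ℝ) ≤ 10 ^ 7 * ε₀)]) hε₀'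
  have hε₁b : 27 * (10 ^ 7 * ε₁) ≤ 1 :=
    le_trans (by nlinarith [mul_le_mul_of_nonneg_right hL3 (by positivity : (0 : ℝ) ≤ 10 ^ 7 * ε₁)]) hε₁'
  have h2 : 3 * (10 ^ 7 * (F.L : ℝ) ^ 2 * ε₀) ≤ 1 :=
    calc 3 * (10 ^ 7 * (F.L : ℝ) ^ 2 * ε₀) ≤ (F.L : ℝ) * (10 ^ 7 * (F.L : ℝ) ^ 2 * ε₀) :=
          mul_le_mul_of_nonneg_right hL (by positivity)
      _ = 10 ^ 7 * (F.L : ℝ) ^ 3 * ε₀ := by ring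
      _ ≤ 1 := hε₀'
  have h3 : 3 * (10 ^ 7 * (F.L : ℝ) ^ 2 * ε₁) ≤ 1 :=
    calc 3 * (10 ^ 7 * (F.L : ℝ) ^ 2 * ε₁) ≤ (F.L : ℝ) * (10 ^ 7 * (F.L : ℝ) ^ 2 * ε₁) :=
          mul_le_mul_of_nonneg_right hL (by positivity)
      _ = 10 ^ 7 * (F.L : ℝ) ^ 3 * ε₁ := by ring
      _ ≤ 1 := hε₁'
  constructor
  · have hC : C0 3 = 11339776 := by simp only [C0]; norm_num
    rw [hC]
    linarith
  · have hc : c2' 3 F.L = 1 / (14336 * (F.L : ℝ) ^ 2) := by simp only [c2']; norm_num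
    have hL2 : (0 : ℝ) < 14336 * (F.L : ℝ) ^ 2 := by positivity
    rw [hc, le_div_iff₀ hL2]
    nlinarith [h2, h3]

/-- ★★★ **THE CHART-ΣS WITNESS** (RULING g26-№19 ORDER (1) «explicit witness `ũ_S`»): for `SU(2)` configurations `U₀`, `U₁` with the based pullbacks of `U₀` and of
`U₁U₀ = emb15 U₀ U₁` inside the Prop.-1∕2 window (`pdev ·♯ < α·L^{−2k}`, `C₀α ≤ ⅓`, `2α ≤ c₂′`), and an exponent `X` whose symmetric accumulated frames `w^{sym}_{iX}(y) =
frameTwS U₀ (iX) y` are `SU(2)`-valued (`hSU`, displayed), there is a fine `SU(2)` gauge transformation `u` with `NormS F n K h U₀ X U₁ u`: `(U₁U₀)^u ∈ Ax_k(𝔅_k, U₀)` and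
`u↓(y) = (w^{sym}_{iX}(y))⁻¹` at every comparison site — §1 with the top datum `c ŷ := (frameTwS U₀ (iX) (siteShift⁻¹ ŷ))⁻¹`.
[cite: Balaban1985RegularSpaces, (1.19) p.79, (1.28)–(1.30) p.81; Balaban1985Averaging, (87) p.31, (97) p.32; Balaban1985Variational, (20) p.281] -/
theorem exists_normS_of_regPr {ε₀ ε₁ : ℝ} (hε₀ : 0 < ε₀) (hε₀' : 10 ^ 7 * (F.L : ℝ) ^ 3 * ε₀ ≤ 1)
    (hε₁ : 0 < ε₁) (hε₁' : 10 ^ 7 * (F.L : ℝ) ^ 3 * ε₁ ≤ 1)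
    {U₀ : GaugeField (F.P K) 0 (Matrix.specialUnitaryGroup (Fin 2) ℂ)} (hU₀ : RegPr F n K ε₀ U₀)
    (X : PBond (F.P K) 0 → Matrix (Fin 2) (Fin 2) ℂ)
    {U₁ : GaugeField (F.P K) 0 (Matrix.specialUnitaryGroup (Fin 2) ℂ)} (hU₁ : RegPr F n K ε₁ (emb15 U₀ U₁))
    (hSU : ∀ y : Site (F.P n) 0, frameTwS F n K h U₀ (fun b => Complex.I • X b) y ∈ specialUnitaryUnits (Fin 2)) :
    ∃ u : GaugeTransf (F.P K) 0 (Matrix.specialUnitaryGroup (Fin 2) ℂ), NormS F n K h U₀ X U₁ u := by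
  letI : CStarAlgebra (Matrix (Fin 2) (Fin 2) ℂ) := B10Eq29TubeLine.cstarAlgebraMatrix 2
  obtain ⟨hα3, hα2⟩ := windows_of_ten7 F (K := K) hε₀.le hε₀' hε₁.le hε₁'
  have hpos : 0 < ((((F.P K).L : ℝ) ^ (K - n))⁻¹) ^ 2 := by
    have : 0 < (((F.P K).L : ℝ) ^ (K - n))⁻¹ := inv_pos.2 (pow_pos (by exact_mod_cast (F.P K).L_pos) _)
    positivity
  have h33 := pdev_pull_lt hε₀ (inAk_pull_of_regPr F hε₀.le hU₀) (basePt F n K)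
  have h34 := pdev_pull_lt hε₁ (inAk_pull_of_regPr F hε₁.le hU₁) (basePt F n K)
  refine exists_normS F h (α := 2 * ε₀ + 2 * ε₁) (by positivity) hα3 hα2 U₀ X U₁ ?_ ?_ hSU
  · calc pdev (pull (unitsField (toUField U₀)) (basePt F n K)) < 2 * ε₀ * ((((F.P K).L : ℝ) ^ (K - n))⁻¹) ^ 2 := h33
      _ ≤ (2 * ε₀ + 2 * ε₁) * ((((F.P K).L : ℝ) ^ (K - n))⁻¹) ^ 2 := by nlinarith
  · calc pdev (pull (unitsField (toUField (emb15 U₀ U₁))) (basePt F n K)) < 2 * ε₁ * ((((F.P K).L : ℝ) ^ (K - n))⁻¹) ^ 2 := h34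
      _ ≤ (2 * ε₀ + 2 * ε₁) * ((((F.P K).L : ℝ) ^ (K - n))⁻¹) ^ 2 := by nlinarith

/-! ## §3 The re-based (20) `AvgCondPrintS` -/

/-- ★ **THE RE-BASED (20) FROM THE (20)ˢ FIBRE CLAUSE AND A WITNESS**: if every fine `u` with the symmetric centre clause puts `(e^{iX}U₀)^u` into `𝔅_k(𝔅_k, V)` (the conclusion
shape of ✓`Prop7SymAvgTwSymEq137.fibreClauseS_of_logChartTwS_eq_mlog` ∕ `…_of_chart47twS`) and a `NormS`-witness exists for `U₁ = expHermField X`, then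
`AvgCondPrintS F n K h V U₀ X` (`U₁ = e^{iX}` bondwise pins `U₁ = expHermField X`, `Prop7Chart5T3OfEq137cov.eq_expHermField_of_exp`).
[cite: Balaban1985Variational, (20) p.281; Balaban1985RegularSpaces, (1.28)–(1.30) p.81] -/
theorem avgCondPrintS_of_fibreClauseS {V : GaugeField (F.P n) 0 (Matrix.specialUnitaryGroup (Fin 2) ℂ)}
    {U₀ : GaugeField (F.P K) 0 (Matrix.specialUnitaryGroup (Fin 2) ℂ)} {X : PBond (F.P K) 0 → Matrix (Fin 2) (Fin 2) ℂ}
    (hX : ∀ b : PBond (F.P K) 0, (X b).IsHermitian ∧ Matrix.trace (X b) = 0)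
    (hfib : ∀ u : GaugeTransf (F.P K) 0 (Matrix.specialUnitaryGroup (Fin 2) ℂ),
      (∀ y : Site (F.P n) 0, Unitary.toUnits (toUGauge (F.P n) 2 (descTransf F n K h u) y) = (frameTwS F n K h U₀ (fun b => Complex.I • X b) y)⁻¹) →
        GaugeField.gaugeAct u (emb15 U₀ (expHermField X)) ∈ fibre F ℰp n K h V)
    (hwit : ∃ u : GaugeTransf (F.P K) 0 (Matrix.specialUnitaryGroup (Fin 2) ℂ), NormS F n K h U₀ X (expHermField X) u) :
    AvgCondPrintS F n K h V U₀ X := by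
  intro U₁ hU₁
  have hU₁X : U₁ = expHermField X := eq_expHermField_of_exp F X hX U₁ hU₁
  subst hU₁X
  obtain ⟨u, hu⟩ := hwit
  exact ⟨u, hu, hfib u hu.2⟩

/-- ★ **THE RE-BASED (20) FROM THE (20)ˢ FIBRE CLAUSE AND A WITNESS**: if every fine `u` with the symmetric centre clause puts `(e^{iX}U₀)^u` into `𝔅_k(𝔅_k, V)` (the conclusion
shape of ✓`Prop7SymAvgTwSymEq137.fibreClauseS_of_logChartTwS_eq_mlog` ∕ `…_of_chart47twS`) and a `NormS`-witness exists for `U₁ = expHermField X`, then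
`AvgCondPrintS F n K h V U₀ X` (`U₁ = e^{iX}` bondwise pins `U₁ = expHermField X`, `Prop7Chart5T3OfEq137cov.eq_expHermField_of_exp`).
[cite: Balaban1985Variational, (20) p.281; Balaban1985RegularSpaces, (1.28)–(1.30) p.81] -/
theorem avgCondPrintS_of_fibreClauseS_of_regPr {ε₀ ε₁ : ℝ} (hε₀ : 0 < ε₀) (hε₀' : 10 ^ 7 * (F.L : ℝ) ^ 3 * ε₀ ≤ 1)
    (hε₁ : 0 < ε₁) (hε₁' : 10 ^ 7 * (F.L : ℝ) ^ 3 * ε₁ ≤ 1)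
    {V : GaugeField (F.P n) 0 (Matrix.specialUnitaryGroup (Fin 2) ℂ)}
    {U₀ : GaugeField (F.P K) 0 (Matrix.specialUnitaryGroup (Fin 2) ℂ)} (hU₀ : RegPr F n K ε₀ U₀)
    {X : PBond (F.P K) 0 → Matrix (Fin 2) (Fin 2) ℂ} (hX : ∀ b : PBond (F.P K) 0, (X b).IsHermitian ∧ Matrix.trace (X b) = 0)
    (hU₁ : RegPr F n K ε₁ (emb15 U₀ (expHermField X)))
    (hSU : ∀ y : Site (F.P n) 0, frameTwS F n K h U₀ (fun b => Complex.I • X b) y ∈ specialUnitaryUnits (Fin 2))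
    (hfib : ∀ u : GaugeTransf (F.P K) 0 (Matrix.specialUnitaryGroup (Fin 2) ℂ),
      (∀ y : Site (F.P n) 0, Unitary.toUnits (toUGauge (F.P n) 2 (descTransf F n K h u) y) = (frameTwS F n K h U₀ (fun b => Complex.I • X b) y)⁻¹) →
        GaugeField.gaugeAct u (emb15 U₀ (expHermField X)) ∈ fibre F ℰp n K h V) :
    AvgCondPrintS F n K h V U₀ X :=
  avgCondPrintS_of_fibreClauseS F h hX hfib (exists_normS_of_regPr F h hε₀ hε₀' hε₁ hε₁' hU₀ X hU₁ hSU)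

/-- ★★ **FILE Aˢ's (20) STEP IN ONE CALL** (RULING g26-№19 ORDER (2)(i): `fibreClauseS_of_chart47twS` ∘ witness ∘ `avgCondPrintS_of_witness`): the hypotheses of
✓`Prop7SymAvgTwSymEq137.fibreClauseS_of_chart47twS` VERBATIM (`Chart47T3twS … U₀ H`, (45)–(46)-twS `QTwS ∘ H = id`, the chart parameter `A′` with `QTwS A′` = print's log
datum and image `A′ − HD(A′) = iX`, `X` Hermitian traceless, `e^{iX}U₀` printed-regular, the two `log` windows) plus `hSU` ⟹ `AvgCondPrintS F n K h V U₀ X`.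
[cite: Balaban1985Variational, (47)–(49) p.285, (20) p.281, Prop. 3 p.289; Balaban1985RegularSpaces, (1.28)–(1.31) pp.81–82, (1.37) p.82] -/
theorem avgCondPrintS_of_chart47twS {C₂ ε ε₀ ε₁ : ℝ} (hε₀ : 0 < ε₀) (hε₀' : 10 ^ 7 * (F.L : ℝ) ^ 3 * ε₀ ≤ 1)
    (hε₁ : 0 < ε₁) (hε₁' : 10 ^ 7 * (F.L : ℝ) ^ 3 * ε₁ ≤ 1)
    {U₀ : GaugeField (F.P K) 0 (Matrix.specialUnitaryGroup (Fin 2) ℂ)} (hU₀ : RegPr F n K ε₀ U₀)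
    {H : (PBond (F.P n) 0 → Matrix (Fin 2) (Fin 2) ℂ) →ₗ[ℂ] (PBond (F.P K) 0 → Matrix (Fin 2) (Fin 2) ℂ)}
    (h47 : Chart47T3twS F n K h C₂ ε U₀ H) (hQH : ∀ Y, QTwS F n K h U₀ (H Y) = Y)
    (V : GaugeField (F.P n) 0 (Matrix.specialUnitaryGroup (Fin 2) ℂ))
    (A' : PBond (F.P K) 0 → Matrix (Fin 2) (Fin 2) ℂ) (hA' : ‖A'‖ < ε)
    (hQA' : QTwS F n K h U₀ A'
      = fun c => mlog (((unitsField (toUField V) c * (unitsField (toUField (descendTo F ℰp n K h U₀)) c)⁻¹ : (Matrix (Fin 2) (Fin 2) ℂ)ˣ) : Matrix (Fin 2) (Fin 2) ℂ)))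
    {X : PBond (F.P K) 0 → Matrix (Fin 2) (Fin 2) ℂ} (hX : ∀ b : PBond (F.P K) 0, (X b).IsHermitian ∧ Matrix.trace (X b) = 0)
    (hAX : A' - H (Dfix (CmapTwS F n K h U₀) H C₂ A') = fun b => Complex.I • X b)
    (hU₁ : RegPr F n K ε₁ (emb15 U₀ (expHermField X)))
    (hwin : ∀ c : PBond (F.P n) 0, ‖((dbarTwS F n K h U₀ (fun b => Complex.I • X b) c : (Matrix (Fin 2) (Fin 2) ℂ)ˣ) : Matrix (Fin 2) (Fin 2) ℂ) - 1‖ < 1)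
    (hwinV : ∀ c : PBond (F.P n) 0,
      ‖((unitsField (toUField V) c * (unitsField (toUField (descendTo F ℰp n K h U₀)) c)⁻¹ : (Matrix (Fin 2) (Fin 2) ℂ)ˣ) : Matrix (Fin 2) (Fin 2) ℂ) - 1‖ < 1)
    (hSU : ∀ y : Site (F.P n) 0, frameTwS F n K h U₀ (fun b => Complex.I • X b) y ∈ specialUnitaryUnits (Fin 2)) :
    AvgCondPrintS F n K h V U₀ X :=
  avgCondPrintS_of_fibreClauseS_of_regPr F h hε₀ hε₀' hε₁ hε₁' hU₀ hX hU₁ hSU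
    (fibreClauseS_of_chart47twS F h hε₀ hε₀' hε₁ hε₁' hU₀ h47 hQH V A' hA' hQA' hX hAX hU₁ hwin hwinV)

/-- ★ **THE EX-STUB CASE `U₀ ∈ 𝔅_k(V)`** (`B = 0`): background in the fibre, `logChartTwS U₀ (iX) = 0`, the window, `e^{iX}U₀` printed-regular, `hSU` ⟹ `AvgCondPrintS F n K h V U₀ X`
(✓`fibreClauseS_of_logChartTwS_eq_zero` ∘ `exists_normS_of_regPr`). [cite: Balaban1985RegularSpaces, (1.13) p.78, (1.37) p.82; Balaban1985Variational, (20) p.281] -/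
theorem avgCondPrintS_of_mem_fibre_of_logChartTwS_eq_zero {ε₀ ε₁ : ℝ} (hε₀ : 0 < ε₀) (hε₀' : 10 ^ 7 * (F.L : ℝ) ^ 3 * ε₀ ≤ 1)
    (hε₁ : 0 < ε₁) (hε₁' : 10 ^ 7 * (F.L : ℝ) ^ 3 * ε₁ ≤ 1)
    {V : GaugeField (F.P n) 0 (Matrix.specialUnitaryGroup (Fin 2) ℂ)}
    {U₀ : GaugeField (F.P K) 0 (Matrix.specialUnitaryGroup (Fin 2) ℂ)} (hU₀V : U₀ ∈ fibre F ℰp n K h V) (hU₀ : RegPr F n K ε₀ U₀)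
    {X : PBond (F.P K) 0 → Matrix (Fin 2) (Fin 2) ℂ} (hX : ∀ b : PBond (F.P K) 0, (X b).IsHermitian ∧ Matrix.trace (X b) = 0)
    (hU₁ : RegPr F n K ε₁ (emb15 U₀ (expHermField X)))
    (hwin : ∀ c : PBond (F.P n) 0, ‖((dbarTwS F n K h U₀ (fun b => Complex.I • X b) c : (Matrix (Fin 2) (Fin 2) ℂ)ˣ) : Matrix (Fin 2) (Fin 2) ℂ) - 1‖ < 1)
    (hlog : Summit.QuantumFields.YangMills.Theorems.Prop7SymAvgTwSym.logChartTwS F n K h U₀ (fun b => Complex.I • X b) = 0)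
    (hSU : ∀ y : Site (F.P n) 0, frameTwS F n K h U₀ (fun b => Complex.I • X b) y ∈ specialUnitaryUnits (Fin 2)) :
    AvgCondPrintS F n K h V U₀ X :=
  avgCondPrintS_of_fibreClauseS_of_regPr F h hε₀ hε₀' hε₁ hε₁' hU₀ hX hU₁ hSU
    (fibreClauseS_of_logChartTwS_eq_zero F h hε₀ hε₀' hε₁ hε₁' hU₀V hU₀ hX hU₁ hwin hlog)

end T3

end Summit.QuantumFields.YangMills.Theorems.Prop7SymSliceWitness

end
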